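import Summits.ResolutionOfSingularities.ResolutionOfSingularities.Theorems.DescentMapKernels
import Summits.ResolutionOfSingularities.ResolutionOfSingularities.Theorems.CofactorCutRoot
import HarnessLib

/-! # DescentMapRoot — decomp-res-lens-4 g40 «DescentMap», FILE B (§135: the route item 27720 `MaxContactCut.WDDescentPortAll` DECIDED
and the g39 root consumers with the descent port DISCHARGED: `ftt_step_of_g40`, `forcedTowersTerminate_of_g40`, `noForcedTowers_of_g40`,
`noForcedTowers_of_g40_residual`). -/

set_option linter.dupNamespace false
set_option linter.unusedSectionVars false

noncomputable section

open CategoryTheory AlgebraicGeometry IsLocalRing TopologicalSpace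
open Literature.AlgebraicGeometry.Resolution
open Summit.ResolutionOfSingularities.ResolutionOfSingularities.Theses
open Summit.ResolutionOfSingularities.ResolutionOfSingularities.Theorems
open WeakOrderReduction ForcedTowerClasses DivergentTowerClasses MonomialTowerClasses
open HugDimensionClasses HugDimensionKernels SurfaceShadowClasses SurfaceShadowKernels
open NearPointCut (SingularClass)
open Scheme.IdealSheafData (vanishingIdeal)
open Literature.AlgebraicGeometry.Resolution.Hironaka2005 (le_idealOrder_of_mul_le le_idealOrder_of_mul_le')

universe u

namespace Summit.ResolutionOfSingularities.ResolutionOfSingularities.Theorems.HugValuationCut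

/-! ## ══ FILE B `Theorems/DescentMapRoot.lean` (§135; imports FILE A + the LANDED `CofactorCutRoot`) ══ -/

section DescentRoot

/-! ## §135 (g40 · NEW · RE-ROOTING) THE ROOT CONSUMERS WITH THE DESCENT PORT DISCHARGED

EXACTLY the g39 root theorems (`ftt_step_of_g39`, `forcedTowersTerminate_of_g39`, `noForcedTowers_of_g39`,
`noForcedTowers_of_g39_residual`) with the binder `hDesc : DescentPort n` / `DescentPortAll` replaced by `descentPort_holds` /
`descentPortAll_holds`; every other hypothesis unchanged and in the same order. -/

/-- **ROUTE ITEM 27720 `MaxContactCut.WDDescentPortAll` (the g16 COSTUME port «∀ n ≥ 1, DescentPort n», aside of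
route MaxContactCut) DECIDED: it holds.** (Sources: BierstoneGrigorievMilmanWlodarczyk2011, §3.1–3.2; Kollar2007, 3.58–3.60;
CossartJannsenSaito2020, §4, §6.) -/
theorem wdDescentPortAll_holds : MaxContactCut.WDDescentPortAll := descentPortAll_holds

/-- **the root piece at weight `n`, port-free in `hDesc`.** [folklore] -/
theorem ftt_step_of_g40 {n : ℕ} (hn : 1 ≤ n) (hMo : MonomialCorner n) (hC : CurveLaw n) (hSL : SurfaceLaw n)
    (hH : HypersurfaceHuggingTowersTerminate n) (hP : ShadowPort n) (hM : MarkingPort n)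
    (hFC : FactorContactPort n) (hCo : CouplingPort n) (hRi : RiderPort n) (h71 : ContactHuggingTowersTerminate n)
    (h640 : SurfaceChainPort)
    (hB : WildLatentFactorNonThreefoldMixedWallFreeFreshJumpShallowCompanionKangarooTowersTerminate n)
    (hK : WildOccultDivisorialThreefoldNonLineRecurrentCompanionCurveFreeBirthRecurrentCofactorBirthRecurrentMixedWallFreeFreshJumpShallowCompanionKangarooTowersTerminate
      n)
    (hC4 : WildOccultDivisorialNonThreefoldMixedWallFreeFreshJumpShallowCompanionKangarooTowersTerminate n)
    (hD4 : WildOccultNonDivisorialNonThreefoldMixedWallFreeFreshJumpShallowCompanionKangarooTowersTerminate n)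
    (hNP : ContactFreeNonPrincipalInLocusTowersTerminate n) (hPu : PurePrincipalTowersTerminate n)
    (hR : IncommensurableWildDriftingImperfectTowersTerminate n)
    (hlow : ∀ n' : ℕ, 1 ≤ n' → n' < n → ForcedTowersTerminate n') : ForcedTowersTerminate n :=
  ftt_step_of_g39 hn hMo hC hSL hH hP hM (descentPort_holds n) hFC hCo hRi h71 h640 hB hK hC4 hD4 hNP hPu hR hlow

/-- **`∀ n ≥ 1, ForcedTowersTerminate n` by strong induction on the weight, port-free in `hDesc`** (the g39 re-rooting theorem with the
descent port discharged). [folklore] -/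
theorem forcedTowersTerminate_of_g40 (hMo : MaxContactCut.MonomialCornerAll) (hC : MaxContactCut.CurveLawAll)
    (hSL : MaxContactCut.SurfaceLawAll) (hH : MaxContactCut.NoHypersurfaceHuggingTowers) (hP : ShadowPortAll)
    (hM : MarkingPortAll) (hFC : FactorContactPortAll) (hCo : CouplingPortAll) (hRi : RiderPortAll)
    (h71 : MaxContactCut.NoContactHuggingTowers) (h640 : SurfaceChainPort) (hB : NoWildLatentFactorNonThreefoldMixedTowers)
    (hcore : ∀ n : ℕ, 1 ≤ n → MinimalAt n →
      WildOccultDivisorialThreefoldNonLineRecurrentCompanionCurveFreeBirthRecurrentCofactorBirthRecurrentMixedWallFreeFreshJumpShallowCompanionKangarooTowersTerminate n)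
    (hC4 : NoWildOccultDivisorialNonThreefoldMixedTowers) (hD4 : NoWildOccultNonDivisorialNonThreefoldMixedTowers)
    (hNP : NoContactFreeNonPrincipalInLocusTowers) (hPu : NoPurePrincipalTowers) (hR : NoIncommensurableWildDriftingImperfectTowers) :
    ∀ n : ℕ, 1 ≤ n → ForcedTowersTerminate n :=
  forcedTowersTerminate_of_g39 hMo hC hSL hH hP hM descentPortAll_holds hFC hCo hRi h71 h640 hB hcore hC4 hD4 hNP hPu hR

/-- **30253 `MaxContactCut.NoForcedTowers` BY NAME from the g39 cells, the ports of `noForcedTowers_of_g22` MINUS THE DESCENT PORT,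
31571, CELL B, C₄, D₄.** [folklore] -/
theorem noForcedTowers_of_g40 (hMo : MaxContactCut.MonomialCornerAll) (hC : MaxContactCut.CurveLawAll)
    (hSL : MaxContactCut.SurfaceLawAll) (hH : MaxContactCut.NoHypersurfaceHuggingTowers) (hP : ShadowPortAll)
    (hM : MarkingPortAll) (hFC : FactorContactPortAll) (hCo : CouplingPortAll) (hRi : RiderPortAll)
    (h71 : MaxContactCut.NoContactHuggingTowers) (h640 : SurfaceChainPort) (hB : NoWildLatentFactorNonThreefoldMixedTowers)
    (hcore : ∀ n : ℕ, 1 ≤ n → MinimalAt n →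
      WildOccultDivisorialThreefoldNonLineRecurrentCompanionCurveFreeBirthRecurrentCofactorBirthRecurrentMixedWallFreeFreshJumpShallowCompanionKangarooTowersTerminate n)
    (hC4 : NoWildOccultDivisorialNonThreefoldMixedTowers) (hD4 : NoWildOccultNonDivisorialNonThreefoldMixedTowers)
    (hNP : NoContactFreeNonPrincipalInLocusTowers) (hPu : NoPurePrincipalTowers) (hR : NoIncommensurableWildDriftingImperfectTowers) :
    MaxContactCut.NoForcedTowers :=
  noForcedTowers_of_g39 hMo hC hSL hH hP hM descentPortAll_holds hFC hCo hRi h71 h640 hB hcore hC4 hD4 hNP hPu hR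

/-- the same from the ABSOLUTE g39 located residual by name. [folklore] -/
theorem noForcedTowers_of_g40_residual (hMo : MaxContactCut.MonomialCornerAll) (hC : MaxContactCut.CurveLawAll)
    (hSL : MaxContactCut.SurfaceLawAll) (hH : MaxContactCut.NoHypersurfaceHuggingTowers) (hP : ShadowPortAll)
    (hM : MarkingPortAll) (hFC : FactorContactPortAll) (hCo : CouplingPortAll) (hRi : RiderPortAll)
    (h71 : MaxContactCut.NoContactHuggingTowers) (h640 : SurfaceChainPort) (hB : NoWildLatentFactorNonThreefoldMixedTowers)
    (hres : NoWildOccultCofactorBirthRecurrentCurveFreeCompanionNonLineMixedTowers)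
    (hNP : NoContactFreeNonPrincipalInLocusTowers) (hPu : NoPurePrincipalTowers) (hR : NoIncommensurableWildDriftingImperfectTowers) :
    MaxContactCut.NoForcedTowers :=
  noForcedTowers_of_g39_residual hMo hC hSL hH hP hM descentPortAll_holds hFC hCo hRi h71 h640 hB hres hNP hPu hR

end DescentRoot

end Summit.ResolutionOfSingularities.ResolutionOfSingularities.Theorems.HugValuationCut
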